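import Summits.Ventures.WeilGRH.TwistedGramCellCheck
import Summits.Ventures.WeilGRH.TwistedSechTable
import Summits.Ventures.WeilGRH.TwistedOddParityTailEven
import HarnessLib

/-!
# GRH arm (rh-explicit, venture WeilGRH): twisted format C — the EVEN-sector cell check of the HYBRID door (parity-1
  kernel), i.e. the `hSe` of `weilPositivityOnChar_of_twistedOdd_formatC_dataFull` / `…_dataP` from kernel data

Cell `rh-explicit`, WEIL TRACK — GRH ARM (engine seat weil-grh-2 gen8).  The door-H/P even sector uses weil-grh-1's
parity-1 kernel `twistedGramCoeffOdd χ a = twistedGramCoeff χ a + (π δ − sechIncrCoeff a)` and the tail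
`U₂⁺ = (1+θ')·U₂⁺[parity 0](θ) + (1+θ'⁻¹)·B(8a/(3π²))²/(3d₀(B₃−1)³)·I` (`oddParity_even_tail_majorant_matrix`, p362770).
This file is gen7's (E2) brick `TwistedGramCellCheck` with the kernel box replaced by
`evenBoxT + evenBonusBox` — the bonus box assembled from this seat's `sech` tables (`TwistedSechTable.lean`:
`SechEncl.offBox`; `TwistedSechTableDiag.lean`: diagonal values) — and the tail box by `u2H`:

* (the literal `sech` tables are validated elsewhere — `TwistedSechTableCheck.lean` / `TwistedSechTableHalfCheck.lean`: this file only CONSUMES their validity statements);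
* `sechBoxZ` / `evenBonusBox` / `evenBoxH` / `schurH` / `cbBox` / `u2H` / `cellH` / `checkCellH` and
  ★ `hSe_of_checkCellH` — for every `x : Fin B → ℝ` the door's `hSe` inequality LITERALLY (kernel `twistedGramCoeffOdd`,
  weights `w_m = wN_{m−B}·2^{−wbits}`, `θ = θN/θD`, `θ' = θpN/θpD`, `d₀ = d0N·2^{−wbits}`).

Sizing: the complete-rung cells `(−3/·) @ 2/5` (`B = 4`, `B₃ = 8`) and `(−3/·), (−4/·) @ (log 3)/2` (`B ≤ 4`, `B₃ ≤ 16`).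
Everything is PROVED; computable `def`s with docstrings; no named facts; RH/GRH-free; standard axioms.
References: H. Yoshida (1992) §§5–7 [Yoshida1992HermitianForms]; R. E. Moore (1966) Ch. 3 [Moore1966].
-/

set_option autoImplicit false

open Real Complex Finset MeasureTheory Set
open scoped BigOperators ArithmeticFunction.vonMangoldt

namespace Summit.Ventures.WeilGRH

open Literature.NumberTheory.LFunctions Literature.NumberTheory.LFunctions.Yoshida1992
open Literature.NumberTheory.LFunctions.Yoshida1992.Encl
open Literature.Analysis.SpecialFunctions Literature.Analysis.ValidatedNumerics.NumericsMP

namespace TwistedEncl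

variable {S : ℕ} {a : ℝ} {q : ℕ}

/-! ## The bonus kernel `π δ − sechIncrCoeff` boxed -/

/-- The bonus entry `π δ_{nm} − sechIncrCoeff a n m` as a real function. -/
noncomputable def bonusE (a : ℝ) (n m : ℤ) : ℝ := (if n = m then π else 0) - sechIncrCoeff a n m

/-- Box of `sechIncrCoeff a n m` for integer modes: the diagonal table at `n = m ≥ 0`, the off-diagonal box from the sine
table otherwise (total: a failed division — impossible when `P.lo > 0` — returns the point `0`).
[cite: Moore1966, Ch. 3 (interval arithmetic: inclusion property)] -/
def sechBoxZ (S : ℕ) (P : MI) (stab dtab : List MI) (n m : ℤ) : MI :=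
  if n = m then dtab.getD n.natAbs default
  else (SechEncl.offBox S P (fun k ↦ stab.getD k default) n m).getD (MI.ofInt S 0)

/-- `sechBoxZ ∋ sechIncrCoeff a n m` for `0 ≤ n`, `|n| < B` on the diagonal, `|n|, |m| < N` off it.
[cite: Moore1966, Ch. 3 (interval arithmetic: inclusion property)] -/
theorem mem_sechBoxZ (hS : 0 < S) {P : MI} (hP : MI.mem S Real.pi P) (hPlo : 0 < P.lo) {N B : ℕ} {stab dtab : List MI}
    (hst : (∀ n : ℕ, n < N → MI.mem S (∫ t in Ioc 0 (2 * a), 1 / (2 * Real.cosh (t / 2)) * Real.sin (π * n / a * t)) (stab.getD n default)))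
    (hdt : (∀ n : ℕ, n < B → MI.mem S (sechIncrCoeff a n n) (dtab.getD n default))) {n m : ℤ}
    (hdiag : n = m → 0 ≤ n ∧ n.natAbs < B) (hn : n.natAbs < N) (hm : m.natAbs < N) :
    MI.mem S (sechIncrCoeff a n m) (sechBoxZ S P stab dtab n m) := by
  unfold sechBoxZ
  split_ifs with hnm
  · obtain ⟨hn0, hnB⟩ := hdiag hnm
    subst hnm
    have e : (n : ℤ) = ((n.natAbs : ℕ) : ℤ) := (Int.natAbs_of_nonneg hn0).symm
    have h := hdt n.natAbs hnB
    rw [← e] at h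
    exact_mod_cast h
  · -- the off-diagonal box: `divPos` by `P·|n−m|` succeeds since `P.lo > 0`
    have htab : ∀ k : ℕ, k < N →
        MI.mem S (∫ t in Ioc 0 (2 * a), 1 / (2 * Real.cosh (t / 2)) * Real.sin (π * k / a * t)) (stab.getD k default) :=
      fun k hk ↦ hst k hk
    -- restrict the table hypothesis to the two modes used (a table valid below `N` suffices: `sinSigned` only reads `|n|, |m|`)
    cases hoff : SechEncl.offBox S P (fun k ↦ stab.getD k default) n m with
    | none =>
      exfalso
      unfold SechEncl.offBox MI.divPos at hoff
      have hlo : 0 < (P.mulInt (n - m).natAbs).lo := by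
        unfold MI.mulInt
        have hk : (0 : ℤ) ≤ ((n - m).natAbs : ℤ) := by positivity
        rw [if_pos hk]
        have hk1 : (1 : ℤ) ≤ ((n - m).natAbs : ℤ) := by
          have : (n - m).natAbs ≠ 0 := Int.natAbs_ne_zero.mpr (sub_ne_zero.mpr hnm)
          omega
        show 0 < P.lo * ((n - m).natAbs : ℤ)
        nlinarith
      rw [if_pos hlo] at hoff
      simp at hoff
    | some Y =>
      simp only [Option.getD_some]
      -- soundness of `offBox` needs the table on ALL naturals; feed a table extended by the true values outside `[0,N)`:
      -- but `offBox` only evaluates `stab` at `|n|` and `|m|`, both `< N`, so we argue directly with `mem_offBox` on a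
      -- modified table function that is valid everywhere and agrees at `|n|, |m|`.
      classical
      let tab' : ℕ → MI := fun k ↦ if k < N then stab.getD k default else
        ⟨0, 0⟩
      -- we cannot produce membership outside `[0,N)`; instead observe `offBox` with `tab'` equals `offBox` with the table
      -- (they agree at `|n|, |m|`), and prove membership via an everywhere-valid oracle table chosen by choice.
      let oracle : ℕ → MI := fun k ↦ if k < N then stab.getD k default else
        MI.ofInt S 0 |>.widen (Int.ceil (|∫ t in Ioc 0 (2 * a), 1 / (2 * Real.cosh (t / 2)) * Real.sin (π * k / a * t)| * S))
      have horacle : ∀ k : ℕ,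
          MI.mem S (∫ t in Ioc 0 (2 * a), 1 / (2 * Real.cosh (t / 2)) * Real.sin (π * k / a * t)) (oracle k) := by
        intro k
        by_cases hk : k < N
        · simp only [oracle, hk, if_true]; exact htab k hk
        · simp only [oracle, hk, if_false]
          refine MI.mem_widen (x := 0) (by simpa using MI.mem_ofInt S 0) ?_
          rw [sub_zero]
          exact Int.le_ceil _
      have hsame : SechEncl.offBox S P oracle n m = SechEncl.offBox S P (fun k ↦ stab.getD k default) n m := by
        unfold SechEncl.offBox SechEncl.sinSigned
        have h1 : oracle n.natAbs = stab.getD n.natAbs default := by simp only [oracle, hn, if_true]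
        have h2 : oracle m.natAbs = stab.getD m.natAbs default := by simp only [oracle, hm, if_true]
        rw [h1, h2]
      have h := SechEncl.mem_offBox hS hP horacle hnm (Y := Y) (by rw [hsame, hoff])
      exact h

/-- Box of the bonus entry `π δ_{nm} − sechIncrCoeff a n m`. [cite: Moore1966, Ch. 3 (interval arithmetic: inclusion property)] -/
def bonusBoxZ (S : ℕ) (P : MI) (stab dtab : List MI) (n m : ℤ) : MI :=
  (if n = m then P else MI.ofInt S 0).sub (sechBoxZ S P stab dtab n m)

/-- `bonusBoxZ ∋ bonusE a n m`. [cite: Moore1966, Ch. 3 (interval arithmetic: inclusion property)] -/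
theorem mem_bonusBoxZ (hS : 0 < S) {P : MI} (hP : MI.mem S Real.pi P) (hPlo : 0 < P.lo) {N B : ℕ} {stab dtab : List MI}
    (hst : (∀ n : ℕ, n < N → MI.mem S (∫ t in Ioc 0 (2 * a), 1 / (2 * Real.cosh (t / 2)) * Real.sin (π * n / a * t)) (stab.getD n default)))
    (hdt : (∀ n : ℕ, n < B → MI.mem S (sechIncrCoeff a n n) (dtab.getD n default))) {n m : ℤ}
    (hdiag : n = m → 0 ≤ n ∧ n.natAbs < B) (hn : n.natAbs < N) (hm : m.natAbs < N) :
    MI.mem S (bonusE a n m) (bonusBoxZ S P stab dtab n m) := by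
  unfold bonusE bonusBoxZ
  refine MI.mem_sub ?_ (mem_sechBoxZ hS hP hPlo hst hdt hdiag hn hm)
  split_ifs
  · exact hP
  · simpa using MI.mem_ofInt S 0

/-- The EVEN-sector bonus box `evenKernel (bonusE a) i m`. [cite: Yoshida1992HermitianForms, §6 (6.10) p. 303] -/
def evenBonusBox (S : ℕ) (P : MI) (stab dtab : List MI) (i m : ℕ) : MI :=
  if i = 0 then bonusBoxZ S P stab dtab 0 m
  else if m = 0 then bonusBoxZ S P stab dtab i 0
  else ((bonusBoxZ S P stab dtab i m).add (bonusBoxZ S P stab dtab i (-(m : ℤ)))).divNat 2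

/-- `evenBonusBox ∋ evenKernel (bonusE a) i m` for `i < B` (diagonal table) and `i, m < N` (sine table).
[cite: Moore1966, Ch. 3 (interval arithmetic: inclusion property)] -/
theorem mem_evenBonusBox (hS : 0 < S) {P : MI} (hP : MI.mem S Real.pi P) (hPlo : 0 < P.lo) {N B : ℕ}
    {stab dtab : List MI} (hst : (∀ n : ℕ, n < N → MI.mem S (∫ t in Ioc 0 (2 * a), 1 / (2 * Real.cosh (t / 2)) * Real.sin (π * n / a * t)) (stab.getD n default)))
    (hdt : (∀ n : ℕ, n < B → MI.mem S (sechIncrCoeff a n n) (dtab.getD n default))) {i m : ℕ} (hiB : i < B)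
    (hi : i < N) (hm : m < N) :
    MI.mem S (evenKernel (bonusE a) i m) (evenBonusBox S P stab dtab i m) := by
  unfold evenKernel evenBonusBox
  have hB0 : 0 < B := by omega
  split_ifs with h0 hm0
  · subst h0
    exact mem_bonusBoxZ hS hP hPlo hst hdt (fun h ↦ ⟨le_rfl, by simpa using hB0⟩) (by simpa using hi) (by simpa using hm)
  · subst hm0
    have := mem_bonusBoxZ hS hP hPlo hst hdt (n := (i : ℤ)) (m := 0)
      (fun h ↦ ⟨by positivity, by simpa using hiB⟩) (by simpa using hi) (by simpa using hm)
    simpa using this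
  · have h1 := mem_bonusBoxZ hS hP hPlo hst hdt (n := (i : ℤ)) (m := (m : ℤ))
      (fun h ↦ ⟨by positivity, by simpa using hiB⟩) (by simpa using hi) (by simpa using hm)
    have h2 := mem_bonusBoxZ hS hP hPlo hst hdt (n := (i : ℤ)) (m := -(m : ℤ))
      (fun h ↦ ⟨by positivity, by simpa using hiB⟩) (by simpa using hi) (by simpa using hm)
    have h := MI.mem_divNat (MI.mem_add h1 h2) (n := 2) (by norm_num)
    exact_mod_cast h

/-! ## The hybrid even-sector kernel box, Schur sum and tail -/

/-- The door-H even-sector kernel box: parity-0 box (table-indexed) + bonus box. [cite: Yoshida1992HermitianForms, §6 (6.10) p. 303] -/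
def evenBoxH (S : ℕ) (C : Consts) (εs : List ℤ) (LQ : MI) (tab : List IdxRec) (P : MI) (stab dtab : List MI)
    (i m : ℕ) : MI :=
  (evenBoxT S C εs LQ tab i m).add (evenBonusBox S P stab dtab i m)

/-- `evenBoxH ∋ evenKernel (twistedGramCoeffOdd χ a) i m`. [cite: Moore1966, Ch. 3 (interval arithmetic: inclusion property)] -/
theorem mem_evenBoxH (hS : 0 < S) (ha0 : 0 < a) {ks : List PrimeLen} (hks : PrimeData a ks) {C : Consts}
    (hC : ConstsValid S a ks C) (χ : DirichletCharacter ℂ q) {εs : List ℤ}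
    (hε : ∀ i < ks.length, (χ (((ks.getD i default).val : ℕ) : ZMod q)).re = ((εs.getD i 0 : ℤ) : ℝ))
    {LQ : MI} (hLQ : MI.mem S (Real.log q) LQ) {N : ℕ} {tab : List IdxRec} (hT : TabValid S a ks N tab)
    {P : MI} (hP : MI.mem S Real.pi P) (hPlo : 0 < P.lo) {B : ℕ} {stab dtab : List MI}
    (hst : (∀ n : ℕ, n < N → MI.mem S (∫ t in Ioc 0 (2 * a), 1 / (2 * Real.cosh (t / 2)) * Real.sin (π * n / a * t)) (stab.getD n default)))
    (hdt : (∀ n : ℕ, n < B → MI.mem S (sechIncrCoeff a n n) (dtab.getD n default)))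
    {i m : ℕ} (hiB : i < B) (hi : i < N) (hm : m < N) :
    MI.mem S (evenKernel (twistedGramCoeffOdd χ a) i m) (evenBoxH S C εs LQ tab P stab dtab i m) := by
  have hsplit : evenKernel (twistedGramCoeffOdd χ a) i m
      = evenKernel (twistedGramCoeff χ a) i m + evenKernel (bonusE a) i m := by
    unfold evenKernel bonusE twistedGramCoeffOdd
    split_ifs <;> ring
  rw [hsplit]
  exact MI.mem_add (mem_evenBoxT hS ha0 hks hC χ hε hLQ hT hi hm) (mem_evenBonusBox hS hP hPlo hst hdt hiB hi hm)

/-- Column sum of the Schur complement for the hybrid kernel. [cite: Yoshida1992HermitianForms, §7 pp. 305–312] -/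
def schurH (S : ℕ) (C : Consts) (εs : List ℤ) (LQ : MI) (tab : List IdxRec) (P : MI) (stab dtab : List MI)
    (wbits : ℕ) (wN : List ℕ) (B i j : ℕ) : ℕ → MI
  | 0 => MI.ofInt S 0
  | c + 1 => (schurH S C εs LQ tab P stab dtab wbits wN B i j c).add
      ((((evenBoxH S C εs LQ tab P stab dtab i (B + c)).mul S (evenBoxH S C εs LQ tab P stab dtab j (B + c))).mulInt
        ((2 : ℤ) ^ wbits)).divNat (wN.getD c 0))

/-- Soundness of `schurH`. [cite: Moore1966, Ch. 3 (interval arithmetic: inclusion property)] -/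
theorem mem_schurH (hS : 0 < S) (ha0 : 0 < a) {ks : List PrimeLen} (hks : PrimeData a ks) {C : Consts}
    (hC : ConstsValid S a ks C) (χ : DirichletCharacter ℂ q) {εs : List ℤ}
    (hε : ∀ i < ks.length, (χ (((ks.getD i default).val : ℕ) : ZMod q)).re = ((εs.getD i 0 : ℤ) : ℝ))
    {LQ : MI} (hLQ : MI.mem S (Real.log q) LQ) {N : ℕ} {tab : List IdxRec} (hT : TabValid S a ks N tab)
    {P : MI} (hP : MI.mem S Real.pi P) (hPlo : 0 < P.lo) {Bd : ℕ} {stab dtab : List MI}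
    (hst : (∀ n : ℕ, n < N → MI.mem S (∫ t in Ioc 0 (2 * a), 1 / (2 * Real.cosh (t / 2)) * Real.sin (π * n / a * t)) (stab.getD n default)))
    (hdt : (∀ n : ℕ, n < Bd → MI.mem S (sechIncrCoeff a n n) (dtab.getD n default)))
    {wbits : ℕ} {wN : List ℕ} {B i j : ℕ} (hiB : i < Bd) (hjB : j < Bd) (hi : i < N) (hj : j < N) :
    ∀ n, B + n ≤ N → (∀ c < n, 0 < wN.getD c 0) →
      MI.mem S (∑ c ∈ Finset.range n, evenKernel (twistedGramCoeffOdd χ a) i (B + c) *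
          evenKernel (twistedGramCoeffOdd χ a) j (B + c) / ((wN.getD c 0 : ℝ) / 2 ^ wbits))
        (schurH S C εs LQ tab P stab dtab wbits wN B i j n)
  | 0, _, _ => by simpa [schurH] using MI.mem_ofInt S 0
  | n + 1, hn, hw => by
      rw [Finset.sum_range_succ, schurH]
      have hmN : B + n < N := by omega
      have hwn : 0 < wN.getD n 0 := hw n (by omega)
      refine MI.mem_add (mem_schurH hS ha0 hks hC χ hε hLQ hT hP hPlo hst hdt hiB hjB hi hj n (by omega)
        (fun c hc ↦ hw c (by omega))) ?_
      have h := MI.mem_divNat (MI.mem_mulInt (MI.mem_mul hS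
        (mem_evenBoxH hS ha0 hks hC χ hε hLQ hT hP hPlo hst hdt hiB hi hmN)
        (mem_evenBoxH hS ha0 hks hC χ hε hLQ hT hP hPlo hst hdt hjB hj hmN)) ((2 : ℤ) ^ wbits)) hwn
      refine mem_of_eq h ?_
      have hw0 : (wN.getD n 0 : ℝ) ≠ 0 := by exact_mod_cast hwn.ne'
      push_cast
      field_simp

/-- The extra rational / box data of a hybrid cell: `θ' = θpN/θpD` and a box `AB ∋ a`. -/
structure HCellExtra where
  /-- `θ'` numerator -/
  θpN : ℕ
  /-- `θ'` denominator -/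
  θpD : ℕ
  /-- box of the half-width `a` -/
  AB : MI
  deriving Repr, Inhabited

/-- The bonus diagonal coefficient `c_b = (1+θ'⁻¹)·B·(8a/(3π²))²/(3 d₀ (B₃−1)³)`, boxed. [cite: Yoshida1992HermitianForms, §7 pp. 305–312] -/
def cbBox (S : ℕ) (C : Consts) (d : EvenCellData) (e : HCellExtra) : MI :=
  let g := (((e.AB.mul S C.invPi).mul S C.invPi).mulInt 8).divNat 3
  (((((g.mul S g).mulInt ((e.θpN : ℤ) + e.θpD)).divNat e.θpN).mulInt ((d.B : ℤ) * 2 ^ d.wbits)).divNat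
    (3 * d.d0N * (d.B3 - 1) ^ 3))

/-- Box of the hybrid tail `U₂⁺_H(i,j) = (1+θ')·U₂⁺(i,j) + δ_{ij} c_b`. [cite: Yoshida1992HermitianForms, §7 pp. 305–312] -/
def u2H (S : ℕ) (C : Consts) (d : EvenCellData) (e : HCellExtra) (i j : ℕ) : MI :=
  (((u2E S C d i j).mulInt ((e.θpD : ℤ) + e.θpN)).divNat e.θpD).add (if i = j then cbBox S C d e else MI.ofInt S 0)

/-- The real hybrid tail entry. [cite: Yoshida1992HermitianForms, §7 pp. 305–312] -/
noncomputable def u2HReal (Sig a' E θ θ' d0 : ℝ) (B B3 : ℕ) (i j : ℕ) : ℝ :=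
  (1 + θ') * u2Real Sig a' E θ d0 B B3 i j +
    (if i = j then (1 + θ'⁻¹) * ((B : ℝ) * (8 * a' / (3 * π ^ 2)) ^ 2 / (3 * d0 * (((B3 - 1 : ℕ) : ℝ)) ^ 3)) else 0)

/-- Soundness of `u2H`. [cite: Moore1966, Ch. 3 (interval arithmetic: inclusion property)] -/
theorem mem_u2H (hS : 0 < S) {ks : List PrimeLen} (hks : PrimeData a ks) {C : Consts} (hC : ConstsValid S a ks C)
    {d : EvenCellData} {e : HCellExtra} (hθN : 0 < d.θN) (hθD : 0 < d.θD) (hθpN : 0 < e.θpN) (hθpD : 0 < e.θpD)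
    (hd0 : 0 < d.d0N) (hB3 : 2 ≤ d.B3) {E : ℝ} (hCC : MI.mem S (a * (1 + E)) d.CC) (hAB : MI.mem S a e.AB) (i j : ℕ) :
    MI.mem S (u2HReal (∑ k ∈ weilPrimeIndex a, (Λ k : ℝ) / Real.sqrt k) a E ((d.θN : ℝ) / d.θD) ((e.θpN : ℝ) / e.θpD)
      ((d.d0N : ℝ) / 2 ^ d.wbits) d.B d.B3 i j) (u2H S C d e i j) := by
  have h0 := mem_u2E hS hks hC hθN hθD hd0 hB3 hCC i j
  have hπ := hC.invPi
  have hB31 : 0 < d.B3 - 1 := by omega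
  unfold u2H u2HReal
  refine MI.mem_add ?_ ?_
  · have h := MI.mem_divNat (MI.mem_mulInt h0 ((e.θpD : ℤ) + e.θpN)) hθpD
    refine mem_of_eq h ?_
    have hθpD' : (e.θpD : ℝ) ≠ 0 := by exact_mod_cast hθpD.ne'
    push_cast
    field_simp
  · by_cases hij : i = j
    · subst hij
      simp only [if_true]
      unfold cbBox
      have hg : MI.mem S (8 * a / (3 * π ^ 2)) ((((e.AB.mul S C.invPi).mul S C.invPi).mulInt 8).divNat 3) := by
        refine mem_of_eq (MI.mem_divNat (MI.mem_mulInt (MI.mem_mul hS (MI.mem_mul hS hAB hπ) hπ) 8) (n := 3)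
          (by norm_num)) ?_
        push_cast; ring
      have h := MI.mem_divNat (MI.mem_mulInt (MI.mem_divNat (MI.mem_mulInt (MI.mem_mul hS hg hg)
        ((e.θpN : ℤ) + e.θpD)) hθpN) ((d.B : ℤ) * 2 ^ d.wbits)) (n := 3 * d.d0N * (d.B3 - 1) ^ 3)
        (Nat.mul_pos (Nat.mul_pos (by norm_num) hd0) (pow_pos hB31 3))
      refine mem_of_eq h ?_
      have hθpN' : (e.θpN : ℝ) ≠ 0 := by exact_mod_cast hθpN.ne'
      have hθpD' : (e.θpD : ℝ) ≠ 0 := by exact_mod_cast hθpD.ne'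
      have hd0' : (d.d0N : ℝ) ≠ 0 := by exact_mod_cast hd0.ne'
      have hB3' : ((d.B3 - 1 : ℕ) : ℝ) ≠ 0 := by exact_mod_cast hB31.ne'
      push_cast
      field_simp
    · simp only [hij, if_false]; simpa using MI.mem_ofInt S 0

/-- The boxed entry of the door-H even-sector matrix `S⁺(i,j)`. [cite: Yoshida1992HermitianForms, §7 pp. 305–312] -/
def cellH (S : ℕ) (C : Consts) (εs : List ℤ) (LQ : MI) (tab : List IdxRec) (P : MI) (stab dtab : List MI)
    (d : EvenCellData) (e : HCellExtra) (i j : ℕ) : MI :=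
  ((evenBoxH S C εs LQ tab P stab dtab i j).sub
      (schurH S C εs LQ tab P stab dtab d.wbits d.wN d.B i j (d.B3 - d.B))).sub (u2H S C d e i j)

/-- Check integer data `D` (unit `2^{−c}`, radius `ρ`) against every boxed entry of the door-H even sector, and the
shape of the rational data. [cite: Moore1966, Ch. 3 (interval arithmetic: inclusion property)] -/
def checkCellH (S : ℕ) (C : Consts) (εs : List ℤ) (LQ : MI) (tab : List IdxRec) (P : MI) (stab dtab : List MI)
    (d : EvenCellData) (e : HCellExtra) (c : ℕ) (ρ : ℤ) (D : List (List ℤ)) : Bool :=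
  decide (2 ≤ d.B) && decide (2 * d.B ≤ d.B3) && decide (0 < d.θN) && decide (0 < d.θD) && decide (0 < d.d0N) &&
    decide (0 < e.θpN) && decide (0 < e.θpD) && decide (0 < P.lo) &&
    (List.range (d.B3 - d.B)).all (fun c' ↦ decide (0 < d.wN.getD c' 0)) &&
    (List.range d.B).all fun i ↦ (List.range d.B).all fun j ↦
      enclCheck S c ρ (PsdDyadic.getMZ D i j) (cellH S C εs LQ tab P stab dtab d e i j)

/-- Unpack `checkCellH`. [cite: Moore1966, Ch. 3 (interval arithmetic: inclusion property)] -/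
theorem checkCellH_spec {C : Consts} {εs : List ℤ} {LQ : MI} {tab : List IdxRec} {P : MI} {stab dtab : List MI}
    {d : EvenCellData} {e : HCellExtra} {c : ℕ} {ρ : ℤ} {D : List (List ℤ)}
    (h : checkCellH S C εs LQ tab P stab dtab d e c ρ D = true) :
    2 ≤ d.B ∧ 2 * d.B ≤ d.B3 ∧ 0 < d.θN ∧ 0 < d.θD ∧ 0 < d.d0N ∧ 0 < e.θpN ∧ 0 < e.θpD ∧ 0 < P.lo ∧
      (∀ c' < d.B3 - d.B, 0 < d.wN.getD c' 0) ∧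
      ∀ i < d.B, ∀ j < d.B, enclCheck S c ρ (PsdDyadic.getMZ D i j) (cellH S C εs LQ tab P stab dtab d e i j) = true := by
  unfold checkCellH at h
  simp only [Bool.and_eq_true, decide_eq_true_eq, List.all_eq_true, List.mem_range] at h
  obtain ⟨⟨⟨⟨⟨⟨⟨⟨⟨h1, h2⟩, h3⟩, h4⟩, h5⟩, h6⟩, h7⟩, h8⟩, h9⟩, h10⟩ := h
  exact ⟨h1, h2, h3, h4, h5, h6, h7, h8, h9, fun i hi j hj ↦ h10 i hi j hj⟩

/-- ★ **The door-H even-sector kernel fact `hSe` from a checked cell** (the `hSe` hypothesis of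
`weilPositivityOnChar_of_twistedOdd_formatC_dataFull` and of `…_dataP`, LITERALLY): valid constants / prime data /
character weights / `log q` box / special-value table below `N ≥ B₃` / `π` box with `P.lo > 0` / `sech` sine table below
`N` and diagonal table below `B` / `CC ∋ a(1 + weilArchDensity(2a))` / `AB ∋ a`; the cell check and the dyadic PSD
certificate of `D`.  [cite: Yoshida1992HermitianForms, §7 pp. 305–312] -/
theorem hSe_of_checkCellH (hS : 0 < S) (ha0 : 0 < a) {ks : List PrimeLen} (hks : PrimeData a ks) {C : Consts}
    (hC : ConstsValid S a ks C) (χ : DirichletCharacter ℂ q) {εs : List ℤ}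
    (hε : ∀ i < ks.length, (χ (((ks.getD i default).val : ℕ) : ZMod q)).re = ((εs.getD i 0 : ℤ) : ℝ))
    {LQ : MI} (hLQ : MI.mem S (Real.log q) LQ) {N : ℕ} {tab : List IdxRec} (hT : TabValid S a ks N tab)
    {P : MI} (hP : MI.mem S Real.pi P) {stab dtab : List MI}
    (hst : (∀ n : ℕ, n < N → MI.mem S (∫ t in Ioc 0 (2 * a), 1 / (2 * Real.cosh (t / 2)) * Real.sin (π * n / a * t)) (stab.getD n default)))
    {d : EvenCellData} {e : HCellExtra} (hdt : (∀ n : ℕ, n < d.B → MI.mem S (sechIncrCoeff a n n) (dtab.getD n default))) (hN : d.B3 ≤ N)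
    (hCC : MI.mem S (a * (1 + weilArchDensity (2 * a))) d.CC) (hAB : MI.mem S a e.AB)
    {c : ℕ} {ρ δ : ℤ} {D L : List (List ℤ)} (hchk : checkCellH S C εs LQ tab P stab dtab d e c ρ D = true)
    (hpsd : PsdDyadic.checkPsdMid d.B δ ρ D L = true) :
    ∀ x : Fin d.B → ℝ, 0 ≤ ∑ i, ∑ j, x i * x j *
      ((if (i : ℕ) = 0 then twistedGramCoeffOdd χ a 0 j else if (j : ℕ) = 0 then twistedGramCoeffOdd χ a i 0
          else (twistedGramCoeffOdd χ a i j + twistedGramCoeffOdd χ a i (-(j : ℤ))) / 2)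
        - (∑ m ∈ Finset.Ico d.B d.B3, (if (i : ℕ) = 0 then twistedGramCoeffOdd χ a 0 m else if m = 0 then twistedGramCoeffOdd χ a i 0
            else (twistedGramCoeffOdd χ a i m + twistedGramCoeffOdd χ a i (-(m : ℤ))) / 2) *
            (if (j : ℕ) = 0 then twistedGramCoeffOdd χ a 0 m else if m = 0 then twistedGramCoeffOdd χ a j 0
            else (twistedGramCoeffOdd χ a j m + twistedGramCoeffOdd χ a j (-(m : ℤ))) / 2) /
            ((d.wN.getD (m - d.B) 0 : ℝ) / 2 ^ d.wbits))
        - ((1 + ((e.θpN : ℝ) / e.θpD)) * ((1 + ((d.θN : ℝ) / d.θD)) * ((1 + 4 / π * (∑ k ∈ weilPrimeIndex a, (Λ k : ℝ) / Real.sqrt k)) / 4) ^ 2 /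
              (((d.d0N : ℝ) / 2 ^ d.wbits) * ((d.B3 - 1 : ℕ) : ℝ)) * ((-1 : ℝ) ^ (i : ℕ) * (-1 : ℝ) ^ (j : ℕ)) +
            (if i = j then (1 + ((d.θN : ℝ) / d.θD)⁻¹) * (d.B / (((d.d0N : ℝ) / 2 ^ d.wbits) * ((d.B3 : ℝ) ^ 2 * ((d.B3 - 1 : ℕ) : ℝ)))) *
              (2 * (i : ℕ) * (∑ k ∈ weilPrimeIndex a, (Λ k : ℝ) / Real.sqrt k) / π +
                (((i : ℕ) : ℝ) / 2 + 8 * a * (1 + weilArchDensity (2 * a)) / (3 * π ^ 2))) ^ 2 else 0))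
            + (if i = j then (1 + ((e.θpN : ℝ) / e.θpD)⁻¹) * ((d.B : ℝ) * (8 * a / (3 * π ^ 2)) ^ 2 /
                (3 * ((d.d0N : ℝ) / 2 ^ d.wbits) * (((d.B3 - 1 : ℕ) : ℝ)) ^ 3)) else 0))) := by
  obtain ⟨hB2, hBB3, hθN, hθD, hd0, hθpN, hθpD, hPlo, hw, hrows⟩ := checkCellH_spec hchk
  set G : ℤ → ℤ → ℝ := twistedGramCoeffOdd χ a with hG
  set Sig : ℝ := ∑ k ∈ weilPrimeIndex a, (Λ k : ℝ) / Real.sqrt k with hSigdef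
  set Sr : ℕ → ℕ → ℝ := fun i j ↦ evenKernel G i j -
      (∑ c' ∈ Finset.range (d.B3 - d.B), evenKernel G i (d.B + c') * evenKernel G j (d.B + c') /
        ((d.wN.getD c' 0 : ℝ) / 2 ^ d.wbits)) -
      u2HReal Sig a (weilArchDensity (2 * a)) ((d.θN : ℝ) / d.θD) ((e.θpN : ℝ) / e.θpD) ((d.d0N : ℝ) / 2 ^ d.wbits)
        d.B d.B3 i j with hSr
  have hmem : ∀ i < d.B, ∀ j < d.B, MI.mem S (Sr i j) (cellH S C εs LQ tab P stab dtab d e i j) := by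
    intro i hi j hj
    have hiN : i < N := by omega
    have hjN : j < N := by omega
    exact MI.mem_sub (MI.mem_sub
      (mem_evenBoxH hS ha0 hks hC χ hε hLQ hT hP hPlo hst hdt hi hiN hjN)
      (mem_schurH hS ha0 hks hC χ hε hLQ hT hP hPlo hst hdt hi hj hiN hjN (d.B3 - d.B) (by omega) hw))
      (mem_u2H hS hks hC hθN hθD hθpN hθpD hd0 (by omega) hCC hAB i j)
  have hnear : ∀ i j : Fin d.B, |Sr i j - (PsdDyadic.getMZ D i j : ℝ) * (1 / 2 ^ c)| ≤ (ρ : ℝ) * (1 / 2 ^ c) :=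
    fun i j ↦ abs_sub_le_of_enclCheck hS (hrows i i.isLt j j.isLt) (hmem i i.isLt j j.isLt)
  have hpsd' := PsdDyadic.psd_of_checkPsdMid hpsd (u := 1 / 2 ^ c) (by positivity) (fun i j ↦ Sr i j) hnear
  intro x
  have key := hpsd' x
  have hIco : ∀ (f : ℕ → ℝ), ∑ m ∈ Finset.Ico d.B d.B3, f m = ∑ c' ∈ Finset.range (d.B3 - d.B), f (d.B + c') :=
    fun f ↦ Finset.sum_Ico_eq_sum_range f d.B d.B3
  refine key.trans_eq (Finset.sum_congr rfl fun i _ ↦ Finset.sum_congr rfl fun j _ ↦ ?_)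
  congr 1
  simp only [hSr, hG, hSigdef, evenKernel, u2HReal, u2Real, hIco, Nat.add_sub_cancel_left, Fin.val_inj]

end TwistedEncl

end Summit.Ventures.WeilGRH
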